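import Summits.AtomisticToContinuum.Crystallization.Theorems.FrustratedLawDichotomyStrainedPatchHomLeafTableDataCert

/-!
# ★★★ A KERNEL-CERTIFIED (P4) fcc GRAM LEAF ON THE CRITICAL LAYER (end-to-end demonstration of the v2 checker line; decomp-a2c hand-1 g20)

The leaf: Gram box of half-width `2⁻¹¹` around the Gram data of `U = √0.9425·diag(1.03, 1, 0.97)` (float margin `x − e_W − 1/625 ≈ 4.1·10⁻⁴`, the
critical-layer size of CERT-DESIGN-g44 §3), target `μ = 2·(1/625 + e_W)·SC`.  ONE `decide +kernel` of `leafCheck` (≈ 0.36 s) + `boxSum_ge_of_leafCheck`.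
`--supports stmt-AtomisticToContinuum-27623`.
-/

noncomputable section

namespace Summit.AtomisticToContinuum.Crystallization.Theorems.FrustratedLawDichotomyStrainedPatchHomLeafTableCheck

open scoped BigOperators RealInnerProductSpace
open Literature.Analysis.ValidatedNumerics.Numerics
open Summit.AtomisticToContinuum.Crystallization.Theorems.ChargedEnergyGapNegative (E3)
open Summit.AtomisticToContinuum.Crystallization.Theorems.FrustratedLawDichotomySchurCut (effPot w₄₅ ω₄)
open Summit.AtomisticToContinuum.Crystallization.Theorems.FrustratedLawDichotomyStrainedPatchHomSplit (latPt)
open Literature.Barriers.AtomisticToContinuum.FlatleyTheil2015 (fccVec)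

/-- The demonstration leaf: U = √0.9425·diag(1+0.030,1,1−0.030) (float margin x−e_W−m ≈ 4.15e-04), hw 2⁻¹¹ -/
def leafCrit : GB := ⟨257450841157797, 124805758382900, 132645082774897, 124805758382900, 265528926698788, 140723168315888, 132645082774897, 140723168315888, 273368251090784, 137438953472, 137438953472, 137438953472, 137438953472, 137438953472, 137438953472, 137438953472, 137438953472, 137438953472⟩

/-- The kernel verdict. [kernel computation] -/
theorem leafCrit_check : leafCheck qTable nearLabels tabE tabA0 tabA1 tabA2 tabA3 tabA4 tabA5 36 leafCrit true 398793747003658 = true := by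
  decide +kernel

/-- ★★★ The certified floor of the demonstration leaf: for every `G` with `‖G − 1‖ ≤ 1/4` whose fcc frame Gram data lie in the box,
`−398793747003658/SC ≤ Σ_{b ∈ [−7,7]³∖0} W₄₅ ‖latPt G fccVec b‖`, i.e. `1/625 ≤ Σ/2 − e_W` up to the rounding of `μ`. [kernel computation + folklore] -/
theorem leafCrit_floor (G : E3 →L[ℝ]
      E3) (hG : ‖G - 1‖ ≤ 1 / 4)
    (hbox : ∀ i j : Fin 3, |⟪G (fccVec i), G (fccVec j)⟫ -
        ((leafCrit.cz i j : ℤ) : ℝ) / SC| ≤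
        ((leafCrit.wz i j : ℤ) : ℝ) / SC) :
    ((sgnZ true 398793747003658 : ℤ) : ℝ) / SC ≤
      ∑ b ∈ (Fintype.piFinset fun _ : Fin 3 => Finset.Icc (-7 : ℤ) 7).filter (fun b => b ≠ 0),
        effPot w₄₅ ω₄ (3 / 400) ‖latPt G fccVec b‖ :=
  boxSum_ge_of_leafCheck leafCrit_check G hG hbox

end Summit.AtomisticToContinuum.Crystallization.Theorems.FrustratedLawDichotomyStrainedPatchHomLeafTableCheck

end
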